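import Summits.Ventures.Crystal3D.Theorems.StickyWulffConstantCoaxialWallLawForcedEnds
import Summits.Ventures.Crystal3D.Theorems.StickyWulffConstantCoaxialWallLawBlockedWindow
import HarnessLib

/-!
# Forced vacant in-plane slots in the clamped wall cell (riser ledger, cell form)

HONEST FRAMING. Part of the venture `Summits/Ventures/Crystal3D` (cell `crystal3d-full`), helper
`--supports` the crux `CoaxialWallLaw` (stmt-Ventures-19481, `route-Ventures-StickyWulffConstant`),
REGISTERED line `WallLedgerF` (planner cf-p1 gen 16), stub `stub_coaxialTwoSlabAdhesion`;
usable by `WallLedgerG` (stmt-Ventures-19480).  Pull-back of `forced_runEnds_offset`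
(`…CoaxialWallLawForcedEnds`) to the crux's cell data, with the blocked window supplied by
`blockedWindow_not_mem` (`…CoaxialWallLawBlockedWindow`).

SETTING = the cell of `CoaxialTwoSlabAdhesion` / `TwoSlabAdhesion`: a unit packing `X` in the
cylinder, containing the complete clamped slab of grain 1 = `A·Λ₀ + t` in `[−2R₀, −R₀]` and of
grain 2 = `A₂·Λ₀ + t₂` in `[h + R₀, h + 2R₀]` (disc radius `ρ`), the two grains DISJOINT as point
sets (translation pairs, non-CSL twins; coincidence sites are separate work), `R₀ ≥ 3`.  A bond
class of grain 1 is given by a unimodular frame `(Ea, Eb, W)` of `Λ₀` spanning `Λ₀` over `ℤ`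
(the three in-plane classes `u, v, u − v` have such frames, `…NoReconstructionGainSampleDeficit`),
climbing: `α = ⟪A W, e₃⟫ > 0`.

**Theorem (`forced_vacantSlots_cell`).**
`√2 α π ρ² − √2 π (6R₀ + 16)(1 + h) ρ ≤ #{x ∈ X ∩ grain 1 : x + A W ∉ X}`.
With `coaxial_sine_le_inPlaneClasses` (sum over the in-plane classes of both grains `≥ 2√6 sin θ`)
this is the riser COUNT: the wall forces `≥ (2√6 sin θ) π ρ² − C(1+h)ρ` vacant in-plane slots, so
the crux's `½ sin θ · π ρ²` follows once each forced vacancy is shown to carry `≥ 1/(4√6)` of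
deficiency (absorption inequality: `…SingleVacancy`, `…DoubleVacancy`, `…Ribbon`, and the open
three-partner lemmas).
WHAT THIS IS NOT: the absorption inequality; coincidence sites; the stub; rung F-C1 not moved.
-/

noncomputable section

namespace Summit.Ventures.Crystal3D.Theorems

open Summit.Ventures.Crystal3D Finset
open Literature.MathematicalPhysics.StatisticalMechanics (fccStacking)
open scoped InnerProductSpace

/-- Arithmetic of the main case: with `r = ρ − 2 − c/α`, `c = h + 3R₀ + 1`, `r ≤ ρ`,
`0 < α ≤ 1`: `√2απρ² − √2π(6R₀+16)(1+h)ρ ≤ √2απr² − 10√2πr`. -/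
theorem forced_vacantSlots_arith_main (α ρ r c h R₀ : ℝ) (hα : 0 < α) (hα1 : α ≤ 1)
    (hρ0 : 0 ≤ ρ) (hh : 0 ≤ h) (hR0 : 3 ≤ R₀) (hc : c = h + 3 * R₀ + 1)
    (hr : r = ρ - 2 - c / α) (hrρ : r ≤ ρ) :
    Real.sqrt 2 * α * Real.pi * ρ ^ 2 - Real.sqrt 2 * Real.pi * (6 * R₀ + 16) * (1 + h) * ρ ≤
      Real.sqrt 2 * α * Real.pi * r ^ 2 - 10 * Real.sqrt 2 * Real.pi * r := by
  have hsqπ : 0 < Real.sqrt 2 * Real.pi := by positivity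
  have hc0 : 0 ≤ c := by rw [hc]; linarith
  have hk0 : 0 ≤ 2 + c / α := by positivity
  have hαk : α * (2 + c / α) = 2 * α + c := by field_simp
  have i1 : α * r ^ 2 = α * ρ ^ 2 - 2 * ρ * (2 * α + c) + (2 * α + c) * (2 + c / α) := by
    have hrk : r = ρ - (2 + c / α) := by rw [hr]; ring
    rw [hrk]
    have : α * (ρ - (2 + c / α)) ^ 2 =
        α * ρ ^ 2 - 2 * ρ * (α * (2 + c / α)) + (α * (2 + c / α)) * (2 + c / α) := by ring
    rw [this, hαk]
  have i2 : 0 ≤ (2 * α + c) * (2 + c / α) := mul_nonneg (by linarith) hk0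
  have i3 : ρ * α ≤ ρ * 1 := mul_le_mul_of_nonneg_left hα1 hρ0
  have e1 : α * ρ ^ 2 - 2 * ρ * (2 + c) ≤ α * r ^ 2 := by nlinarith [i1, i2, i3]
  have h4 : Real.sqrt 2 * Real.pi * (α * ρ ^ 2 - 2 * ρ * (2 + c)) ≤
      Real.sqrt 2 * Real.pi * (α * r ^ 2) := mul_le_mul_of_nonneg_left e1 hsqπ.le
  have h5 : Real.sqrt 2 * Real.pi * r ≤ Real.sqrt 2 * Real.pi * ρ :=
    mul_le_mul_of_nonneg_left hrρ hsqπ.le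
  have h3 : (2 * h + 6 * R₀ + 16) * ρ ≤ (6 * R₀ + 16) * (1 + h) * ρ := by
    apply mul_le_mul_of_nonneg_right _ hρ0
    nlinarith [mul_nonneg hh (by linarith : (0 : ℝ) ≤ R₀)]
  have h6 : Real.sqrt 2 * Real.pi * ((2 * h + 6 * R₀ + 16) * ρ) ≤
      Real.sqrt 2 * Real.pi * ((6 * R₀ + 16) * (1 + h) * ρ) := mul_le_mul_of_nonneg_left h3 hsqπ.le
  have h7 : Real.sqrt 2 * Real.pi * (α * ρ ^ 2 - 2 * ρ * (2 + c)) =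
      Real.sqrt 2 * α * Real.pi * ρ ^ 2 - Real.sqrt 2 * Real.pi * ((2 * h + 6 * R₀ + 16) * ρ) +
        10 * (Real.sqrt 2 * Real.pi * ρ) := by rw [hc]; ring
  have h8 : Real.sqrt 2 * Real.pi * (α * r ^ 2) = Real.sqrt 2 * α * Real.pi * r ^ 2 := by ring
  have h9 : Real.sqrt 2 * Real.pi * ((6 * R₀ + 16) * (1 + h) * ρ) =
      Real.sqrt 2 * Real.pi * (6 * R₀ + 16) * (1 + h) * ρ := by ring
  linarith [h4, h5, h6, h7, h8, h9]

/-- Arithmetic of the degenerate case: if `r = ρ − 2 − c/α < R₀` then the claimed bound is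
non-positive. -/
theorem forced_vacantSlots_arith_deg (α ρ r c h R₀ : ℝ) (hα : 0 < α) (hα1 : α ≤ 1)
    (hρ0 : 0 ≤ ρ) (hh : 0 ≤ h) (hR0 : 3 ≤ R₀) (hc : c = h + 3 * R₀ + 1)
    (hr : r = ρ - 2 - c / α) (hcase : r < R₀) :
    Real.sqrt 2 * α * Real.pi * ρ ^ 2 - Real.sqrt 2 * Real.pi * (6 * R₀ + 16) * (1 + h) * ρ ≤ 0 := by
  have hsqπ : 0 < Real.sqrt 2 * Real.pi := by positivity
  have hR0' : (0 : ℝ) ≤ R₀ := by linarith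
  have hαρ : α * ρ ≤ 4 * R₀ + h + 3 := by
    have h1 : ρ - 2 - c / α < R₀ := by rw [← hr]; exact hcase
    have h2' : α * (ρ - 2 - c / α) = α * ρ - 2 * α - c := by field_simp
    have h3 : α * (ρ - 2 - c / α) < α * R₀ := mul_lt_mul_of_pos_left h1 hα
    rw [h2'] at h3
    have h4 : α * R₀ ≤ 1 * R₀ := mul_le_mul_of_nonneg_right hα1 hR0'
    rw [hc] at h3
    linarith
  have h3 : α * ρ * ρ ≤ (4 * R₀ + h + 3) * ρ := mul_le_mul_of_nonneg_right hαρ hρ0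
  have h4' : 4 * R₀ + h + 3 ≤ (6 * R₀ + 16) * (1 + h) := by
    nlinarith [mul_nonneg hh hR0']
  have h4 : (4 * R₀ + h + 3) * ρ ≤ (6 * R₀ + 16) * (1 + h) * ρ :=
    mul_le_mul_of_nonneg_right h4' hρ0
  have h5 := mul_le_mul_of_nonneg_left (h3.trans h4) hsqπ.le
  have h6 : Real.sqrt 2 * Real.pi * (α * ρ * ρ) = Real.sqrt 2 * α * Real.pi * ρ ^ 2 := by ring
  have h7 : Real.sqrt 2 * Real.pi * ((6 * R₀ + 16) * (1 + h) * ρ) =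
      Real.sqrt 2 * Real.pi * (6 * R₀ + 16) * (1 + h) * ρ := by ring
  linarith

/-- **Forced vacant slots of a climbing bond class in the clamped cell.**  See the module
docstring.  `hframe`/`hspan`: `(Ea, Eb, W)` is a unimodular frame of `Λ₀` spanning it over `ℤ`. -/
theorem forced_vacantSlots_cell
    (A : EuclideanSpace ℝ (Fin 3) ≃ₗᵢ[ℝ] EuclideanSpace ℝ (Fin 3)) (t : EuclideanSpace ℝ (Fin 3))
    [DecidablePred fun p : EuclideanSpace ℝ (Fin 3) =>
      p ∈ (fun q => A q + t) '' fccStacking 1 (Real.sqrt (2 / 3))]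
    (A₂ : EuclideanSpace ℝ (Fin 3) ≃ₗᵢ[ℝ] EuclideanSpace ℝ (Fin 3)) (t₂ : EuclideanSpace ℝ (Fin 3))
    (X : Finset (EuclideanSpace ℝ (Fin 3)))
    (hX : ∀ p ∈ X, ∀ q ∈ X, p ≠ q → 1 ≤ dist p q)
    (R₀ h ρ : ℝ) (hR₀ : 3 ≤ R₀) (hh : 0 ≤ h) (hρ : R₀ ≤ ρ)
    (hP₁ : ∀ p ∈ (fun q => A q + t) '' fccStacking 1 (Real.sqrt (2 / 3)),
      -(2 * R₀) ≤ p 2 → p 2 ≤ -R₀ → p 0 ^ 2 + p 1 ^ 2 ≤ ρ ^ 2 → p ∈ X)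
    (hP₂ : ∀ p ∈ (fun q => A₂ q + t₂) '' fccStacking 1 (Real.sqrt (2 / 3)),
      h + R₀ ≤ p 2 → p 2 ≤ h + 2 * R₀ → p 0 ^ 2 + p 1 ^ 2 ≤ ρ ^ 2 → p ∈ X)
    (hdisj : ∀ p ∈ (fun q => A q + t) '' fccStacking 1 (Real.sqrt (2 / 3)),
      p ∉ (fun q => A₂ q + t₂) '' fccStacking 1 (Real.sqrt (2 / 3)))
    (Ea Eb W : EuclideanSpace ℝ (Fin 3)) (hEa : ‖Ea‖ ≤ 1) (hEb : ‖Eb‖ ≤ 1) (hW : ‖W‖ = 1)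
    (hdet : (Matrix.det ![WithLp.ofLp Ea, WithLp.ofLp Eb, WithLp.ofLp W]) ^ 2 = 1 / 2)
    (hframe : ∀ a b τ : ℤ,
      (a : ℝ) • Ea + (b : ℝ) • Eb + (τ : ℝ) • W ∈ fccStacking 1 (Real.sqrt (2 / 3)))
    (hspan : ∀ q ∈ fccStacking 1 (Real.sqrt (2 / 3)), ∃ a b τ : ℤ,
      q = (a : ℝ) • Ea + (b : ℝ) • Eb + (τ : ℝ) • W)
    (hα : 0 < ⟪A W, EuclideanSpace.single (2 : Fin 3) (1 : ℝ)⟫_ℝ) :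
    Real.sqrt 2 * ⟪A W, EuclideanSpace.single (2 : Fin 3) (1 : ℝ)⟫_ℝ * Real.pi * ρ ^ 2 -
        Real.sqrt 2 * Real.pi * (6 * R₀ + 16) * (1 + h) * ρ ≤
      (((X.filter fun p => p ∈ (fun q => A q + t) '' fccStacking 1 (Real.sqrt (2 / 3))).filter
        fun p => p + A W ∉ X).card : ℝ) := by
  classical
  set X₁ := X.filter fun p => p ∈ (fun q => A q + t) '' fccStacking 1 (Real.sqrt (2 / 3)) with hX₁
  -- pulled-back normal and offset
  set e₃ : EuclideanSpace ℝ (Fin 3) := EuclideanSpace.single (2 : Fin 3) (1 : ℝ) with he₃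
  have hν : ∃ ν : EuclideanSpace ℝ (Fin 3), ν = A.symm e₃ := ⟨_, rfl⟩
  obtain ⟨ν, hν⟩ := hν
  have hs : ∃ s : EuclideanSpace ℝ (Fin 3), s = A.symm t := ⟨_, rfl⟩
  obtain ⟨s, hs⟩ := hs
  have he₃n : ‖e₃‖ = 1 := by rw [he₃, PiLp.norm_single, norm_one]
  have hνn : ‖ν‖ = 1 := by rw [hν, LinearIsometryEquiv.norm_map, he₃n]
  have hAν : A ν = e₃ := by rw [hν, LinearIsometryEquiv.apply_symm_apply]
  have hAs : A s = t := by rw [hs, LinearIsometryEquiv.apply_symm_apply]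
  have hαW : ⟪A W, e₃⟫_ℝ = ⟪W, ν⟫_ℝ := by rw [← hAν, LinearIsometryEquiv.inner_map_map]
  rw [hαW] at hα ⊢
  have hα1 : ⟪W, ν⟫_ℝ ≤ 1 := by
    have h1 := abs_real_inner_le_norm W ν
    rw [hW, hνn, one_mul] at h1
    exact (le_abs_self _).trans h1
  -- the motion (as plain functions; `g q = A q + t` definitionally)
  let g : EuclideanSpace ℝ (Fin 3) → EuclideanSpace ℝ (Fin 3) := fun q => A q + t
  let ginv : EuclideanSpace ℝ (Fin 3) → EuclideanSpace ℝ (Fin 3) := fun p => A.symm (p - t)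
  have hg_ginv : ∀ p, g (ginv p) = p := by
    intro p; simp only [g, ginv, LinearIsometryEquiv.apply_symm_apply]; abel
  have hginv_g : ∀ q, ginv (g q) = q := by
    intro q; simp only [g, ginv, add_sub_cancel_right, LinearIsometryEquiv.symm_apply_apply]
  have hgq : ∀ q, g q = A (q + s) := by intro q; simp only [g, map_add, hAs]
  have h2 : ∀ q, g q 2 = ⟪q + s, ν⟫_ℝ := by
    intro q
    have : g q 2 = ⟪g q, e₃⟫_ℝ := by rw [he₃, EuclideanSpace.inner_single_right]; simp
    rw [this, hgq, ← hAν, LinearIsometryEquiv.inner_map_map]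
  have hlat : ∀ q, g q 0 ^ 2 + g q 1 ^ 2 = ‖q + s‖ ^ 2 - ⟪q + s, ν⟫_ℝ ^ 2 := by
    intro q
    rw [sq_add_sq_eq_norm_sq_sub, ← he₃, hgq, LinearIsometryEquiv.norm_map, ← hAν,
      LinearIsometryEquiv.inner_map_map]
  have hgmem : ∀ q, q ∈ fccStacking 1 (Real.sqrt (2 / 3)) →
      g q ∈ (fun q => A q + t) '' fccStacking 1 (Real.sqrt (2 / 3)) := fun q hq => ⟨q, hq, rfl⟩
  have hgmem' : ∀ q, g q ∈ (fun q => A q + t) '' fccStacking 1 (Real.sqrt (2 / 3)) →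
      q ∈ fccStacking 1 (Real.sqrt (2 / 3)) := by
    rintro q ⟨q', hq', hqq'⟩
    have : q' = q := by
      have h1 : ginv (g q') = ginv (g q) := congrArg ginv hqq'
      rwa [hginv_g, hginv_g] at h1
    rw [← this]; exact hq'
  -- the pulled-back occupied sites of grain 1
  set S : Finset (EuclideanSpace ℝ (Fin 3)) := X₁.image ginv with hS
  have hmemS : ∀ q, q ∈ S ↔ g q ∈ X₁ := by
    intro q
    rw [hS, mem_image]
    constructor
    · rintro ⟨p, hp, rfl⟩; rw [hg_ginv]; exact hp
    · intro hq; exact ⟨g q, hq, hginv_g q⟩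
  have hSlat : ∀ x ∈ S, ∃ a b τ : ℤ, x = (a : ℝ) • Ea + (b : ℝ) • Eb + (τ : ℝ) • W := by
    intro x hx
    rw [hmemS, hX₁, mem_filter] at hx
    exact hspan x (hgmem' x hx.2)
  -- windows and the anchor radius
  set α : ℝ := ⟪W, ν⟫_ℝ with hαdef
  set lo₁ : ℝ := -(2 * R₀) with hlo₁
  set lo₂ : ℝ := h + R₀ + 1 with hlo₂
  set c : ℝ := h + 3 * R₀ + 1 with hc
  set r : ℝ := ρ - 2 - c / α with hr
  have hc0 : 0 ≤ c := by rw [hc]; linarith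
  have hρ0 : 0 ≤ ρ := by linarith
  have hsqπ : 0 < Real.sqrt 2 * Real.pi := by positivity
  -- `W ∈ Λ₀`, so slots of grain-1 balls are grain-1 sites
  have hWΛ : W ∈ fccStacking 1 (Real.sqrt (2 / 3)) := by
    have := hframe 0 0 1; simpa using this
  -- the count in the cell equals the pulled-back count
  have hcount : ((S.filter fun x => x + W ∉ S).card : ℝ) =
      ((X₁.filter fun p => p + A W ∉ X).card : ℝ) := by
    have hginj : Function.Injective g := by
      intro q q' hqq'
      have h1 : ginv (g q) = ginv (g q') := congrArg ginv hqq'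
      rwa [hginv_g, hginv_g] at h1
    have himg : (S.filter fun x => x + W ∉ S).image g = X₁.filter fun p => p + A W ∉ X := by
      ext p
      rw [mem_image, mem_filter]
      constructor
      · rintro ⟨q, hq, rfl⟩
        rw [mem_filter] at hq
        obtain ⟨hqS, hqW⟩ := hq
        refine ⟨(hmemS q).1 hqS, fun hmem => hqW ?_⟩
        rw [hmemS, hX₁, mem_filter]
        have hgqW : g (q + W) = g q + A W := by simp only [g, map_add]; abel
        have hq1 : g q ∈ X₁ := (hmemS q).1 hqS
        rw [hX₁, mem_filter] at hq1
        rw [hgqW]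
        exact ⟨hmem, movedFcc_add_site_mem A t hq1.2 hWΛ⟩
      · rintro ⟨hp, hpW⟩
        refine ⟨ginv p, ?_, hg_ginv p⟩
        rw [mem_filter]
        refine ⟨(hmemS _).2 (by rw [hg_ginv]; exact hp), fun hmem => hpW ?_⟩
        rw [hmemS, hX₁, mem_filter] at hmem
        have hgqW : g (ginv p + W) = p + A W := by
          simp only [g, ginv, map_add, LinearIsometryEquiv.apply_symm_apply]; abel
        rw [hgqW] at hmem
        exact hmem.1
    rw [← himg, card_image_of_injective _ hginj]
  suffices final : Real.sqrt 2 * α * Real.pi * ρ ^ 2 -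
      Real.sqrt 2 * Real.pi * (6 * R₀ + 16) * (1 + h) * ρ ≤
      ((S.filter fun x => x + W ∉ S).card : ℝ) by
    rw [hcount] at final
    exact final
  by_cases hcase : R₀ ≤ r
  · -- main case: apply the pulled-back count with anchor radius `r`
    have hr0 : 0 ≤ r := by linarith
    have hrρ : r ≤ ρ := by
      rw [hr]; have : 0 ≤ c / α := by positivity
      linarith
    have hcomplete : ∀ a b τ : ℤ,
        lo₁ ≤ ⟪(a : ℝ) • Ea + (b : ℝ) • Eb + (τ : ℝ) • W + s, ν⟫_ℝ →
        ⟪(a : ℝ) • Ea + (b : ℝ) • Eb + (τ : ℝ) • W + s, ν⟫_ℝ ≤ lo₁ + R₀ →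
        ‖(a : ℝ) • Ea + (b : ℝ) • Eb + (τ : ℝ) • W + s‖ ^ 2 -
            ⟪(a : ℝ) • Ea + (b : ℝ) • Eb + (τ : ℝ) • W + s, ν⟫_ℝ ^ 2 ≤ r ^ 2 →
        (a : ℝ) • Ea + (b : ℝ) • Eb + (τ : ℝ) • W ∈ S := by
      intro a b τ h1 h2' h3
      rw [hmemS, hX₁, mem_filter]
      refine ⟨hP₁ _ (hgmem _ (hframe a b τ)) ?_ ?_ ?_, hgmem _ (hframe a b τ)⟩
      · rw [h2]; rw [hlo₁] at h1; exact h1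
      · rw [h2]; rw [hlo₁] at h2'; linarith
      · rw [hlat]
        have : r ^ 2 ≤ ρ ^ 2 := pow_le_pow_left₀ hr0 hrρ 2
        linarith
    have hblocked : ∀ a b τ : ℤ,
        lo₂ ≤ ⟪(a : ℝ) • Ea + (b : ℝ) • Eb + (τ : ℝ) • W + s, ν⟫_ℝ →
        ⟪(a : ℝ) • Ea + (b : ℝ) • Eb + (τ : ℝ) • W + s, ν⟫_ℝ ≤ lo₂ + (R₀ - 2) →
        ‖(a : ℝ) • Ea + (b : ℝ) • Eb + (τ : ℝ) • W + s‖ ^ 2 -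
            ⟪(a : ℝ) • Ea + (b : ℝ) • Eb + (τ : ℝ) • W + s, ν⟫_ℝ ^ 2 ≤ (ρ - 1) ^ 2 →
        (a : ℝ) • Ea + (b : ℝ) • Eb + (τ : ℝ) • W ∉ S := by
      intro a b τ h1 h2' h3 hmem
      rw [hmemS, hX₁, mem_filter] at hmem
      have hgq := hgmem _ (hframe a b τ)
      have hnot := blockedWindow_not_mem A₂ t₂ X hX (h + R₀) (h + 2 * R₀) ρ (by linarith) hP₂
        (g ((a : ℝ) • Ea + (b : ℝ) • Eb + (τ : ℝ) • W)) (hdisj _ hgq)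
        (by rw [h2]; rw [hlo₂] at h1; linarith) (by rw [h2]; rw [hlo₂] at h2'; linarith)
        (by rw [hlat]; exact h3)
      exact hnot hmem.1
    have hreach : r + (lo₂ - lo₁) / α + 1 ≤ ρ - 1 := by
      have e : lo₂ - lo₁ = c := by rw [hlo₂, hlo₁, hc]; ring
      rw [e, hr]; linarith
    have key := forced_runEnds_offset ν hνn Ea Eb W s hEa hEb hW hdet hα R₀ r lo₁ lo₂ (R₀ - 2)
      (ρ - 1) (by linarith) hcase (by linarith) (by rw [hlo₁, hlo₂]; linarith) hreach S hSlat
      hcomplete hblocked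
    exact (forced_vacantSlots_arith_main α ρ r c h R₀ hα hα1 hρ0 hh hR₀ hc hr hrρ).trans key
  · -- degenerate case: the claimed bound is non-positive
    push Not at hcase
    have hcard : (0 : ℝ) ≤ ((S.filter fun x => x + W ∉ S).card : ℝ) := Nat.cast_nonneg _
    have e1 := forced_vacantSlots_arith_deg α ρ r c h R₀ hα hα1 hρ0 hh hR₀ hc hr hcase
    linarith

end Summit.Ventures.Crystal3D.Theorems

end
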